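import Mathlib
import Summits.Ventures.PercRepro2.SureEdge
import Summits.Ventures.PercRepro2.CoincA3Main
import Summits.Ventures.PercRepro2.XhatPin

/-!
# The mean field factorises across the edge `{a₃, o}` (blind cell PercRepro2, night-1 g17;
NIGHT1-G17.md §4)

Let `f = {a₃, o}` have weight `q = p f`.  At `q = 1` the sure edge identifies `a₃` with `o`
(`SureEdge`), where the mean field vanishes (`Coinc.Xhat_a3_eq_o`), `D_o = P(PD, o ∈ U) = 0`
(`Coinc.PD_o_inter_oL/oH`) and `E_Q[σ_o] = E_Q[σ₃ 1_{o∈U}]` (`Coinc.T_o_inter`, `T'_o_inter`,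
`T_o_eq`).  Each of these is affine in `q` (the pinning identity; `XhatPin.Xhat_eq_pin` for the mean
field), hence `(1 − q)` times its value at `q = 0`, and the cleared mean field factorises:

* **`HMFc_eq_factor_o`**: `HMFc = (1 − q) · Φ_o` with the explicit cofactor
  `Φ_o = 2 Z (D_o⁰ W − X̂⁰ D) − gap (D_o⁰ (Z − S₃) − D (EQo⁰ − S₃o⁰))`
  (`Z = P(Q)`, `W = M₂ + Δ_T`, `D = P(PD)`, `gap`, `S₃ = E_Q[σ₃]` at the weights `p`; superscript
  `0` = at `p[f ↦ 0]`).

Together with `RootEdge.HMFc_eq_factor` (the root edges), the coincidence loci `a₃ ∈ {a₁, a₂, o}`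
are simple zeros of `HMFc` along the corresponding edge with explicit cofactors; (HMF) across the
edge `{a₃, o}` of weight `< 1` is `Φ_o ≥ 0` (`HMF_iff_PhiO_nonneg`).  Own code; standard axioms.
-/

namespace Summit.Ventures.PercRepro2

open UnionCluster CovForm

namespace OEdge

section Factor

variable {V : Type*} {E : Type*} [Fintype E] [DecidableEq E] [Fintype V] [DecidableEq V]
  {R : Type*} [Field R] [LinearOrder R] [IsStrictOrderedRing R]

variable (p : E → R) (ends : E → Sym2 V) (o a₁ a₂ a₃ b : V) (f : E)

/-- **The cofactor `Φ_o`** of `(1 − p f)` in `HMFc` for an edge `f = {a₃, o}`: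
`2 Z (D_o⁰ W − X̂⁰ D) − gap (D_o⁰ (Z − S₃) − D (EQo⁰ − S₃o⁰))`, the masses with superscript `0`
taken at the weights `p[f ↦ 0]`, the others at `p`. -/
noncomputable def PhiO : R :=
  2 * prob p (avoidAll ends a₂ {a₁}) *
      (Do (Function.update p f 0) ends o a₁ a₂ a₃ *
          (massM2 p ends a₁ a₂ a₃ b + deltaT p ends a₁ a₂ a₃ b) -
        Xhat (Function.update p f 0) ends o a₁ a₂ a₃ b * prob p (PDEvent ends a₁ a₂ a₃)) -
    gap p ends a₁ a₂ b *
      (Do (Function.update p f 0) ends o a₁ a₂ a₃ *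
          (prob p (avoidAll ends a₂ {a₁}) - EQ3 p ends a₁ a₂ a₃) -
        prob p (PDEvent ends a₁ a₂ a₃) *
          (EQo (Function.update p f 0) ends o a₁ a₂ - EQ3o (Function.update p f 0) ends o a₁ a₂ a₃))

variable {a₁ a₂ a₃ f}

omit [Fintype V] [DecidableEq V] [LinearOrder R] [IsStrictOrderedRing R] in
/-- With `f = {a₃, o}` pinned open, `P(PD, o ∈ C₁) = 0`. -/
lemma prob_PD_oL_update_one (hf : ends f = s(a₃, o)) :
    prob (Function.update p f 1) (PDEvent ends a₁ a₂ a₃ ∩ connEvent ends a₁ o) = 0 := by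
  rw [SureEdge.prob_PD (Function.update p f 1) (by simp) hf a₁ a₂, Coinc.PD_o_inter_oL,
    prob_empty]

omit [Fintype V] [DecidableEq V] [LinearOrder R] [IsStrictOrderedRing R] in
/-- With `f = {a₃, o}` pinned open, `P(PD, o ∈ C₂) = 0`. -/
lemma prob_PD_oH_update_one (hf : ends f = s(a₃, o)) :
    prob (Function.update p f 1) (PDEvent ends a₁ a₂ a₃ ∩ connEvent ends a₂ o) = 0 := by
  rw [SureEdge.prob_PD (Function.update p f 1) (by simp) hf a₁ a₂, Coinc.PD_o_inter_oH,
    prob_empty]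

omit [LinearOrder R] [IsStrictOrderedRing R] in
/-- With `f = {a₃, o}` pinned open, the mean field vanishes. -/
lemma Xhat_update_one (hf : ends f = s(a₃, o)) :
    Xhat (Function.update p f 1) ends o a₁ a₂ a₃ b = 0 := by
  rw [SureEdge.Xhat_sure (Function.update p f 1) (by simp) hf o a₁ a₂ b, Coinc.Xhat_a3_eq_o]

omit [Fintype V] [DecidableEq V] [LinearOrder R] [IsStrictOrderedRing R] in
/-- With `f = {a₃, o}` pinned open, `E_Q[σ_o] = E_Q[σ₃ 1_{o ∈ U}]`. -/
lemma EQo_sub_EQ3o_update_one (hf : ends f = s(a₃, o)) :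
    EQo (Function.update p f 1) ends o a₁ a₂ - EQ3o (Function.update p f 1) ends o a₁ a₂ a₃ = 0 := by
  unfold EQo EQ3o
  rw [SureEdge.prob_T (Function.update p f 1) (by simp) hf a₂ a₁,
    SureEdge.prob_T (Function.update p f 1) (by simp) hf a₂ a₁,
    SureEdge.prob_T (Function.update p f 1) (by simp) hf a₁ a₂,
    SureEdge.prob_T (Function.update p f 1) (by simp) hf a₁ a₂,
    (Coinc.T'_o_inter ends o a₁ a₂).1, (Coinc.T'_o_inter ends o a₁ a₂).2,
    (Coinc.T_o_inter ends o a₁ a₂).1, (Coinc.T_o_inter ends o a₁ a₂).2,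
    (Coinc.T_o_eq ends o a₁ a₂).1, (Coinc.T_o_eq ends o a₁ a₂).2, prob_empty]
  ring

omit [LinearOrder R] [IsStrictOrderedRing R] in
/-- The pinning identity for a mass vanishing at `p f = 1`. -/
lemma prob_eq_of_update_one_eq_zero (A : Set (Config E))
    (h : prob (Function.update p f 1) A = 0) :
    prob p A = (1 - p f) * prob (Function.update p f 0) A := by
  rw [prob_eq_pin p A f, h]; ring

omit [LinearOrder R] [IsStrictOrderedRing R] in
/-- **The mean field factorises across the edge `{a₃, o}`**: `HMFc = (1 − p f) · Φ_o`. -/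
theorem HMFc_eq_factor_o (hf : ends f = s(a₃, o)) :
    HMFc p ends o a₁ a₂ a₃ b = (1 - p f) * PhiO p ends o a₁ a₂ a₃ b f := by
  have hDoL := prob_eq_of_update_one_eq_zero p (PDEvent ends a₁ a₂ a₃ ∩ connEvent ends a₁ o)
    (prob_PD_oL_update_one p ends o hf)
  have hDoH := prob_eq_of_update_one_eq_zero p (PDEvent ends a₁ a₂ a₃ ∩ connEvent ends a₂ o)
    (prob_PD_oH_update_one p ends o hf)
  have hX : Xhat p ends o a₁ a₂ a₃ b = (1 - p f) * Xhat (Function.update p f 0) ends o a₁ a₂ a₃ b := by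
    rw [XhatPin.Xhat_eq_pin p ends o a₁ a₂ a₃ b (by rw [hf]; exact Sym2.mem_mk_left a₃ o),
      Xhat_update_one p ends o b hf]
    ring
  have h1 := EQo_sub_EQ3o_update_one p ends o (a₁ := a₁) (a₂ := a₂) hf
  have hQoL := prob_eq_pin p (avoidAll ends a₂ {a₁} ∩ connEvent ends a₁ o) f
  have hQoH := prob_eq_pin p (avoidAll ends a₂ {a₁} ∩ connEvent ends a₂ o) f
  have hT'oL := prob_eq_pin p (TEvent ends a₂ a₁ a₃ ∩ connEvent ends a₁ o) f
  have hT'oH := prob_eq_pin p (TEvent ends a₂ a₁ a₃ ∩ connEvent ends a₂ o) f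
  have hToL := prob_eq_pin p (TEvent ends a₁ a₂ a₃ ∩ connEvent ends a₁ o) f
  have hToH := prob_eq_pin p (TEvent ends a₁ a₂ a₃ ∩ connEvent ends a₂ o) f
  unfold HMFc CovForm.marginC CovForm.DEF PhiO CovForm.Do CovForm.EQo CovForm.EQ3o
  unfold CovForm.EQo CovForm.EQ3o at h1
  rw [hDoL, hDoH, hX, hQoL, hQoH, hT'oL, hT'oH, hToL, hToH]
  linear_combination (gap p ends a₁ a₂ b * prob p (PDEvent ends a₁ a₂ a₃) * p f) * h1

/-- **(HMF) across the edge `{a₃, o}` of weight `< 1` is the sign of the cofactor `Φ_o`.** -/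
theorem HMF_iff_PhiO_nonneg (hf : ends f = s(a₃, o)) (hq : p f < 1) :
    HMF p ends o a₁ a₂ a₃ b ↔ 0 ≤ PhiO p ends o a₁ a₂ a₃ b f := by
  unfold HMF
  rw [HMFc_eq_factor_o p ends o b hf]
  have h : 0 < 1 - p f := by linarith
  exact mul_nonneg_iff_of_pos_left h

end Factor

end OEdge

end Summit.Ventures.PercRepro2
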